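import Literature.AlgebraicGeometry.Motives.HodgeStructureLefschetzGroupPoints
import Literature.AlgebraicGeometry.Motives.HodgeStructureCentralizerDirectSum
import Literature.AlgebraicGeometry.Motives.HodgeStructureEndAlgCentralizerPoints
import Literature.AlgebraicGeometry.Motives.HodgeStructureProdPolarization
import HarnessLib

/-!
# Milne 1999, Proposition 1.5 ON `K`-POINTS for the abstract polarized `ℚ`-Hodge structure: `S(H₁ ⊕ H₂)(K) ⊆ S(H₁)(K) × S(H₂)(K)`
# (block-diagonal embedding) for every field `K ⊇ ℚ`, with equality iff `Hom(H₁, H₂) = 0 = Hom(H₂, H₁)`;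
# `S(H ⊕ H)(K) = Δ S(H)(K)`; the product form after extension of scalars

[topic AlgebraicGeometry/Motives]

Layer `Literature/AlgebraicGeometry/Motives`, lane `lit-hodgefound` (Track 2 foundations library; seat `lit-hodgefound-p34`,
generation 18, self-proposed row g18-#5 of `run/shared/lean/pub/lit-hodgefound/SKELETON.md`). THEOREMS ONLY (no definition,
no named fact; net debt `0`). Fifth file of the seat's programme «Milne 1999 §1 on the abstract polarized `ℚ`-Hodge structure,
on `K`-points»: the `K`-points rider of g18-#4 `Motives/HodgeStructureLefschetzGroupDirectSum` (which treats the `ℚ`-points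
`S(H)(ℚ) = Polarization.lefschetzGroup`). Milne's `S(A)` is an ALGEBRAIC GROUP over the coefficient field `k` of the Weil
cohomology, and Proposition 1.5 is an isomorphism of algebraic groups; read through the functor of points (Remark 1.6:
replacing `k` by a field `k' ⊇ k` replaces `S(A)` by `S(A)_{k'}`) it is, for the Betti theory of a complex abelian variety
(`k = ℚ`) and every field `K ⊇ ℚ`, a statement about the groups `S(H)(K) = Polarization.lefschetzGroupBaseChange K Q ≤ GL(K ⊗_ℚ V)`
of g18-#1 `Motives/HodgeStructureLefschetzGroupPoints` (the `γ` commuting with every `a_K`, `a ∈ E_φ = End_HS(H)`, and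
preserving `Q_K`). This file proves that statement for binary direct sums `H₁ ⊕ H₂ = H₁.prod H₂` polarized by the tree's
product polarization `Q₁.prod Q₂` (`Motives/HodgeStructureProdPolarization`), with the block-diagonal embedding
`blockDiag K V₁ V₂ : GL(K ⊗ V₁) × GL(K ⊗ V₂) →* GL(K ⊗ (V₁ ⊕ V₂))` and the restriction-to-a-retract `restrictRetract` of the
tree's `Motives/MumfordTateGroupDirectSum` (Moonen's Lemma 4.6 machinery, there used for `MT(H₁ ⊕ H₂)(K)`), the four blocks of
`End_HS(H₁ ⊕ H₂)` of g18-#3 `Motives/HodgeStructureCentralizerDirectSum`, and the `blockDiag` calculus of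
`Motives/HodgeStructureEndAlgCentralizerPoints`. The torus-level twin (real points, products of period lattices) is p22's
`Kaehler/ComplexTorusLefschetzGroupFiniteProduct` and the `ℂ`-points twin on `H¹(A(ℂ); ℂ)` is `Milne1999/LefschetzGroupProducts` —
OTHER carriers, BY NAME, nothing imported or restated.

## The source, verbatim

J. S. Milne, *Lefschetz classes on abelian varieties*, Duke Math. J. **96** (1999) 639–675 [Milne1999LefschetzClasses]
(held `paper:doi-10-1215-s0012-7094-99-09620-5`, author's folios; Duke page ≈ folio + 638):
* §1 p0006 L16–L20 (p. 644): "**The group `S(A)`.** For an abelian variety `A` over `Ω`, we define `S(A)` to be the algebraic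
  subgroup of `GL(V(A))` such that, for all commutative `k`-algebras `R`, `S(A)(R) = {γ ∈ C(A) ⊗_k R | γ†γ = 1}`. Thus, for any
  ample divisor `D` on `A`, `S(A)` is the largest algebraic subgroup of `Sp(e_D)` whose elements commute with the endomorphisms
  of `A`."
* §1 p0006 L24–L29 (p. 644): "**Proposition 1.5.** Let `A₁, …, A_s` be a set of representatives for the simple isogeny
  factors of `A`, so that there exists an isogeny `A₁^{r₁} × ⋯ × A_s^{r_s} → A` for some `rᵢ > 0`. Any such isogeny induces
  an isomorphism `S(A₁) × ⋯ × S(A_s) → S(A)`, which is independent of the choice of the isogeny. Proof. This is an immediate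
  consequence of Proposition 1.1." (Prop. 1.1 / p. 643: "`C(A) ⊂ C(A₁) × ⋯ × C(A_s)`, with equality holding if and only if
  `Hom(Aᵢ, Aⱼ) = 0` for all `i ≠ j`".)
* §1 p0006 L30–L34 (p. 644): "**Remark 1.6.** If `X ↦ H*(X)` is a Weil cohomology theory with coefficient field `k`, and `k'`
  is a field containing `k`, then `X ↦ H*(X) ⊗_k k'` is a Weil cohomology theory with coefficient field `k'`. If `C'(A)` and
  `S'(A)` denote the objects defined relative to the second theory, then there are canonical isomorphisms `C'(A) ≅ C(A) ⊗_k k'`,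
  `S'(A) ≅ S(A)_{/k'}`."
* §3 p0016 L16–L17 (p. 654): "It follows from Proposition 1.5 that `S(A) = S(A^r)`".
* B. Moonen, *An introduction to Mumford–Tate groups* (2004) [Moonen2004MT], §4 Lemma 4.6 (restriction of an automorphism of
  `V₁ ⊕ V₂` commuting with the projectors to the summands; the tree's `restrictRetract`, `blockDiag`).

## What is PROVED (binary direct sums, `K`-points for every field `K ⊇ ℚ`; `r = 2`)

* §0 **the product form after extension of scalars**: `(Q₁ ⊕ Q₂)_K(x, y) = (Q₁)_K(pr₁ x, pr₁ y) + (Q₂)_K(pr₂ x, pr₂ y)`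
  (`Polarization.baseChange_prod_form_apply`; `prᵢ = (fst/snd)_K`).
* §1 **`S(H₁ ⊕ H₂)(K) ⊆ S(H₁)(K) × S(H₂)(K)`**: an element `γ ∈ S(H₁ ⊕ H₂)(K)` commutes with the base-changed Hodge
  idempotents `(in₁ pr₁)_K`, `(in₂ pr₂)_K` (`inl_fst_baseChange_apply_of_mem_lefschetzGroupBaseChange_prod`, `inr_snd_…`), its
  restrictions `pr₁ γ in₁`, `pr₂ γ in₂` lie in `S(H₁)(K)`, `S(H₂)(K)` (`restrictRetract_inl_fst_mem_lefschetzGroupBaseChange`,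
  `restrictRetract_inr_snd_mem_lefschetzGroupBaseChange`), `γ` is the block-diagonal automorphism they define
  (`eq_blockDiag_of_mem_lefschetzGroupBaseChange_prod`), hence
  **`lefschetzGroupBaseChange_prod_le_map_blockDiag : S(H₁ ⊕ H₂)(K) ≤ (S(H₁)(K) × S(H₂)(K)).map blockDiag`**.
* §2 **`γ₁ ⊕ γ₂ ∈ S(H₁ ⊕ H₂)(K)`, exactly** (`blockDiag_mem_lefschetzGroupBaseChange_prod_iff`): iff `γᵢ ∈ S(Hᵢ)(K)` and the
  pair intertwines the base change of every morphism between the summands (`f_K γ₁ = γ₂ f_K` for `f : H₁ → H₂`,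
  `g_K γ₂ = γ₁ g_K` for `g : H₂ → H₁`) — Prop. 1.1's intertwining relations, on `K`-points.
* §3 **Proposition 1.5 on `K`-points (`s = 2`)**: `γ₁ ⊕ γ₂ ∈ S(H₁ ⊕ H₂)(K)` for ALL `γᵢ ∈ S(Hᵢ)(K)` iff `Hom(H₁, H₂) = 0` and
  `Hom(H₂, H₁) = 0` (`forall_blockDiag_mem_lefschetzGroupBaseChange_prod_iff`; "⟹" tests `(1, -1)` and descends `f_K = 0 ⟹ f = 0`
  by faithful flatness of `K/ℚ`, Mathlib's `LinearMap.baseChangeHom_injective`); then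
  **`lefschetzGroupBaseChange_prod_eq_map_blockDiag_of_hom_eq_zero : S(H₁ ⊕ H₂)(K) = (S(H₁)(K) × S(H₂)(K)).map blockDiag`**, an
  isomorphism onto its image by the tree's `blockDiag_injective` (Mathlib's `Subgroup.equivMapOfInjective`).
* §4 **"`S(A) = S(A^r)`" on `K`-points (`r = 2`)**: `γ₁ ⊕ γ₂ ∈ S(H ⊕ H)(K) ⟺ γ₁ = γ₂ ∈ S(H)(K)`
  (`blockDiag_mem_lefschetzGroupBaseChange_prod_self_iff`), `S(H ⊕ H)(K) = Δ S(H)(K)`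
  (`lefschetzGroupBaseChange_prod_self_eq_map_diagEmbedding`, `mem_lefschetzGroupBaseChange_prod_self_iff`).

NOT here: `s > 2` summands and `r > 2` (iterate), the isogeny clause ("independent of the choice of the isogeny"; for
abstract Hodge structures an isogeny is an isomorphism and transport is routine), the involution clause of Prop. 1.1 on
`K`-points, and the algebraic group `S(A)` itself (only its groups of `K`-points, as everywhere in the lane).

## References

* [Milne1999LefschetzClasses] J. S. Milne, *Lefschetz classes on abelian varieties*, Duke Math. J. 96 (1999) 639–675, §1
  p. 644 (the group `S(A)`, Proposition 1.5, Remark 1.6), p. 643 (Proposition 1.1), §3 p. 654 ("S(A) = S(A^r)").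
* [Moonen2004MT] B. Moonen, *An introduction to Mumford–Tate groups* (2004), §4 Lemma 4.6.
* [DeligneHodgeII1971] P. Deligne, *Théorie de Hodge II*, Publ. Math. IHÉS 40 (1971), 2.1, 2.1.15 (direct sums, morphisms,
  the product polarization).
* [BourbakiAlgebraI1989] N. Bourbaki, *Algebra I*, Ch. II §5 no. 3 Prop. 7 (extension of scalars is faithful over a field).
-/

noncomputable section

open TensorProduct

namespace Literature.AlgebraicGeometry.Motives

namespace HodgeStructure

universe u uK

variable (K : Type uK) [Field K] [Algebra ℚ K]
  {V₁ : Type u} [AddCommGroup V₁] [Module ℚ V₁] {V₂ : Type u} [AddCommGroup V₂] [Module ℚ V₂] {n : ℤ}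
  {H₁ : HodgeStructure V₁ n} {H₂ : HodgeStructure V₂ n} (Q₁ : Polarization H₁) (Q₂ : Polarization H₂)

/-! ## §0 Base change of the block calculus on `V₁ ⊕ V₂` and of the product form -/

section Plumbing

/-- `pr₁ in₁ = id` after base change: `fst_K (inl_K x) = x`. Private plumbing. [folklore] -/
private theorem fst_baseChange_inl_baseChange' (x : K ⊗[ℚ] V₁) :
    (LinearMap.fst ℚ V₁ V₂).baseChange K ((LinearMap.inl ℚ V₁ V₂).baseChange K x) = x :=
  baseChange_retract_apply K (ι := LinearMap.inl ℚ V₁ V₂) (π := LinearMap.fst ℚ V₁ V₂) (fun _ ↦ rfl) x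

/-- `snd_K (inr_K y) = y`. Private plumbing. [folklore] -/
private theorem snd_baseChange_inr_baseChange' (y : K ⊗[ℚ] V₂) :
    (LinearMap.snd ℚ V₁ V₂).baseChange K ((LinearMap.inr ℚ V₁ V₂).baseChange K y) = y :=
  baseChange_retract_apply K (ι := LinearMap.inr ℚ V₁ V₂) (π := LinearMap.snd ℚ V₁ V₂) (fun _ ↦ rfl) y

/-- `snd_K (inl_K x) = 0`. Private plumbing. [folklore] -/
private theorem snd_baseChange_inl_baseChange' (x : K ⊗[ℚ] V₁) :
    (LinearMap.snd ℚ V₁ V₂).baseChange K ((LinearMap.inl ℚ V₁ V₂).baseChange K x) = 0 := by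
  rw [← LinearMap.comp_apply, ← LinearMap.baseChange_comp, LinearMap.snd_comp_inl, LinearMap.baseChange_zero,
    LinearMap.zero_apply]

/-- `fst_K (inr_K y) = 0`. Private plumbing. [folklore] -/
private theorem fst_baseChange_inr_baseChange' (y : K ⊗[ℚ] V₂) :
    (LinearMap.fst ℚ V₁ V₂).baseChange K ((LinearMap.inr ℚ V₁ V₂).baseChange K y) = 0 := by
  rw [← LinearMap.comp_apply, ← LinearMap.baseChange_comp, LinearMap.fst_comp_inr, LinearMap.baseChange_zero,
    LinearMap.zero_apply]

/-- The two base-changed idempotents sum to the identity: `inl_K (fst_K z) + inr_K (snd_K z) = z`. Private plumbing. [folklore] -/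
private theorem inl_fst_add_inr_snd_baseChange_apply (z : K ⊗[ℚ] (V₁ × V₂)) :
    (LinearMap.inl ℚ V₁ V₂).baseChange K ((LinearMap.fst ℚ V₁ V₂).baseChange K z) +
        (LinearMap.inr ℚ V₁ V₂).baseChange K ((LinearMap.snd ℚ V₁ V₂).baseChange K z) = z := by
  rw [← LinearMap.comp_apply, ← LinearMap.baseChange_comp, ← LinearMap.comp_apply, ← LinearMap.baseChange_comp,
    ← LinearMap.add_apply, ← LinearMap.baseChange_add]
  have : LinearMap.inl ℚ V₁ V₂ ∘ₗ LinearMap.fst ℚ V₁ V₂ + LinearMap.inr ℚ V₁ V₂ ∘ₗ LinearMap.snd ℚ V₁ V₂ = LinearMap.id := by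
    ext <;> simp
  rw [this, LinearMap.baseChange_id, LinearMap.id_apply]

/-- Base change of an endomorphism of `V₁ ⊕ V₂` on the first summand, through its blocks:
`a_K (inl_K x) = inl_K ((pr₁ a in₁)_K x) + inr_K ((pr₂ a in₁)_K x)`. Private plumbing. [folklore] -/
private theorem baseChange_apply_inl_baseChange (a : Module.End ℚ (V₁ × V₂)) (x : K ⊗[ℚ] V₁) :
    a.baseChange K ((LinearMap.inl ℚ V₁ V₂).baseChange K x) =
      (LinearMap.inl ℚ V₁ V₂).baseChange K ((LinearMap.fst ℚ V₁ V₂ ∘ₗ a ∘ₗ LinearMap.inl ℚ V₁ V₂).baseChange K x) +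
        (LinearMap.inr ℚ V₁ V₂).baseChange K ((LinearMap.snd ℚ V₁ V₂ ∘ₗ a ∘ₗ LinearMap.inl ℚ V₁ V₂).baseChange K x) := by
  simp only [LinearMap.baseChange_comp, LinearMap.coe_comp, Function.comp_apply]
  exact (inl_fst_add_inr_snd_baseChange_apply K _).symm

/-- The same on the second summand: `a_K (inr_K y) = inl_K ((pr₁ a in₂)_K y) + inr_K ((pr₂ a in₂)_K y)`. Private plumbing. [folklore] -/
private theorem baseChange_apply_inr_baseChange (a : Module.End ℚ (V₁ × V₂)) (y : K ⊗[ℚ] V₂) :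
    a.baseChange K ((LinearMap.inr ℚ V₁ V₂).baseChange K y) =
      (LinearMap.inl ℚ V₁ V₂).baseChange K ((LinearMap.fst ℚ V₁ V₂ ∘ₗ a ∘ₗ LinearMap.inr ℚ V₁ V₂).baseChange K y) +
        (LinearMap.inr ℚ V₁ V₂).baseChange K ((LinearMap.snd ℚ V₁ V₂ ∘ₗ a ∘ₗ LinearMap.inr ℚ V₁ V₂).baseChange K y) := by
  simp only [LinearMap.baseChange_comp, LinearMap.coe_comp, Function.comp_apply]
  exact (inl_fst_add_inr_snd_baseChange_apply K _).symm

/-- **The product form after extension of scalars, componentwise**: `(Q₁ ⊕ Q₂)_K(x, y) = (Q₁)_K(pr₁ x, pr₁ y) + (Q₂)_K(pr₂ x, pr₂ y)`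
for every field `K ⊇ ℚ` (`prᵢ` the base-changed projections; the tree's `Polarization.baseChange_prod_form` is the case `K = ℂ`
through `prodEquiv`). Checked on pure tensors. [cite: DeligneHodgeII1971, 2.1.15] [cite: Milne1999LefschetzClasses, §1 p. 643 L21–L27 and Remark 1.6] -/
theorem Polarization.baseChange_prod_form_apply (x y : K ⊗[ℚ] (V₁ × V₂)) :
    (Q₁.prod Q₂).form.baseChange K x y =
      Q₁.form.baseChange K ((LinearMap.fst ℚ V₁ V₂).baseChange K x) ((LinearMap.fst ℚ V₁ V₂).baseChange K y) +
        Q₂.form.baseChange K ((LinearMap.snd ℚ V₁ V₂).baseChange K x) ((LinearMap.snd ℚ V₁ V₂).baseChange K y) := by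
  induction x using TensorProduct.induction_on with
  | zero => simp only [map_zero, LinearMap.zero_apply, zero_add]
  | tmul a v =>
    induction y using TensorProduct.induction_on with
    | zero => simp only [map_zero, add_zero]
    | tmul b w =>
      simp only [LinearMap.baseChange_tmul, LinearMap.fst_apply, LinearMap.snd_apply, LinearMap.BilinForm.baseChange_tmul,
        Polarization.prod_form_apply, add_smul]
    | add y₁ y₂ h₁ h₂ =>
      simp only [map_add, h₁, h₂]
      abel
  | add x₁ x₂ h₁ h₂ =>
    simp only [map_add, LinearMap.add_apply, h₁, h₂]
    abel

end Plumbing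

/-! ## §1 `S(H₁ ⊕ H₂)(K) ⊆ S(H₁)(K) × S(H₂)(K)`: block-diagonality and the blocks -/

section Restrict

variable {K Q₁ Q₂}

/-- An element of `S(H₁ ⊕ H₂)(K)` commutes with the base-changed Hodge idempotent `(in₁ pr₁)_K` (`in₁ pr₁ ∈ End_HS(H₁ ⊕ H₂)`,
and `S(H)(K)` commutes with `E_φ ⊗ K`). [cite: Moonen2004MT, §4 Lemma 4.6] [cite: Milne1999LefschetzClasses, §1 Prop. 1.5 and Remark 1.6] -/
theorem Polarization.inl_fst_baseChange_apply_of_mem_lefschetzGroupBaseChange_prod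
    {γ : (K ⊗[ℚ] (V₁ × V₂)) ≃ₗ[K] (K ⊗[ℚ] (V₁ × V₂))} (hγ : γ ∈ (Q₁.prod Q₂).lefschetzGroupBaseChange K)
    (z : K ⊗[ℚ] (V₁ × V₂)) :
    (LinearMap.inl ℚ V₁ V₂).baseChange K ((LinearMap.fst ℚ V₁ V₂).baseChange K (γ z)) =
      γ ((LinearMap.inl ℚ V₁ V₂).baseChange K ((LinearMap.fst ℚ V₁ V₂).baseChange K z)) := by
  have h : (LinearMap.inl ℚ V₁ V₂ ∘ₗ LinearMap.fst ℚ V₁ V₂).baseChange K (γ z) =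
      γ ((LinearMap.inl ℚ V₁ V₂ ∘ₗ LinearMap.fst ℚ V₁ V₂).baseChange K z) :=
    hγ.1 ⟨LinearMap.inl ℚ V₁ V₂ ∘ₗ LinearMap.fst ℚ V₁ V₂,
      Hom.toLinearMap_mem_endAlg ((Hom.prodInl H₁ H₂).comp (Hom.prodFst H₁ H₂))⟩ z
  simpa only [LinearMap.baseChange_comp, LinearMap.coe_comp, Function.comp_apply] using h

/-- The same for `(in₂ pr₂)_K`. [cite: Moonen2004MT, §4 Lemma 4.6] [cite: Milne1999LefschetzClasses, §1 Prop. 1.5 and Remark 1.6] -/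
theorem Polarization.inr_snd_baseChange_apply_of_mem_lefschetzGroupBaseChange_prod
    {γ : (K ⊗[ℚ] (V₁ × V₂)) ≃ₗ[K] (K ⊗[ℚ] (V₁ × V₂))} (hγ : γ ∈ (Q₁.prod Q₂).lefschetzGroupBaseChange K)
    (z : K ⊗[ℚ] (V₁ × V₂)) :
    (LinearMap.inr ℚ V₁ V₂).baseChange K ((LinearMap.snd ℚ V₁ V₂).baseChange K (γ z)) =
      γ ((LinearMap.inr ℚ V₁ V₂).baseChange K ((LinearMap.snd ℚ V₁ V₂).baseChange K z)) := by
  have h : (LinearMap.inr ℚ V₁ V₂ ∘ₗ LinearMap.snd ℚ V₁ V₂).baseChange K (γ z) =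
      γ ((LinearMap.inr ℚ V₁ V₂ ∘ₗ LinearMap.snd ℚ V₁ V₂).baseChange K z) :=
    hγ.1 ⟨LinearMap.inr ℚ V₁ V₂ ∘ₗ LinearMap.snd ℚ V₁ V₂,
      Hom.toLinearMap_mem_endAlg ((Hom.prodInr H₁ H₂).comp (Hom.prodSnd H₁ H₂))⟩ z
  simpa only [LinearMap.baseChange_comp, LinearMap.coe_comp, Function.comp_apply] using h

/-- Block-diagonality, I: for `γ ∈ S(H₁ ⊕ H₂)(K)` the `(2,1)`-block vanishes, `pr₂ (γ (in₁ x)) = 0`.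
[cite: Milne1999LefschetzClasses, §1 Prop. 1.5 and p. 643 ("C(A) ⊂ C(A₁) × ⋯ × C(A_s)")] [cite: Moonen2004MT, §4 Lemma 4.6] -/
theorem Polarization.snd_baseChange_apply_inl_baseChange_of_mem_lefschetzGroupBaseChange_prod
    {γ : (K ⊗[ℚ] (V₁ × V₂)) ≃ₗ[K] (K ⊗[ℚ] (V₁ × V₂))} (hγ : γ ∈ (Q₁.prod Q₂).lefschetzGroupBaseChange K) (x : K ⊗[ℚ] V₁) :
    (LinearMap.snd ℚ V₁ V₂).baseChange K (γ ((LinearMap.inl ℚ V₁ V₂).baseChange K x)) = 0 := by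
  have h := Polarization.inr_snd_baseChange_apply_of_mem_lefschetzGroupBaseChange_prod hγ ((LinearMap.inl ℚ V₁ V₂).baseChange K x)
  rw [snd_baseChange_inl_baseChange', map_zero, map_zero] at h
  have h' := congrArg ((LinearMap.snd ℚ V₁ V₂).baseChange K) h
  rwa [snd_baseChange_inr_baseChange', map_zero] at h'

/-- Block-diagonality, II: for `γ ∈ S(H₁ ⊕ H₂)(K)` the `(1,2)`-block vanishes, `pr₁ (γ (in₂ y)) = 0`.
[cite: Milne1999LefschetzClasses, §1 Prop. 1.5 and p. 643] [cite: Moonen2004MT, §4 Lemma 4.6] -/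
theorem Polarization.fst_baseChange_apply_inr_baseChange_of_mem_lefschetzGroupBaseChange_prod
    {γ : (K ⊗[ℚ] (V₁ × V₂)) ≃ₗ[K] (K ⊗[ℚ] (V₁ × V₂))} (hγ : γ ∈ (Q₁.prod Q₂).lefschetzGroupBaseChange K) (y : K ⊗[ℚ] V₂) :
    (LinearMap.fst ℚ V₁ V₂).baseChange K (γ ((LinearMap.inr ℚ V₁ V₂).baseChange K y)) = 0 := by
  have h := Polarization.inl_fst_baseChange_apply_of_mem_lefschetzGroupBaseChange_prod hγ ((LinearMap.inr ℚ V₁ V₂).baseChange K y)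
  rw [fst_baseChange_inr_baseChange', map_zero, map_zero] at h
  have h' := congrArg ((LinearMap.fst ℚ V₁ V₂).baseChange K) h
  rwa [fst_baseChange_inl_baseChange', map_zero] at h'

/-- **The first block `pr₁ γ in₁` of `γ ∈ S(H₁ ⊕ H₂)(K)` lies in `S(H₁)(K)`** (as the automorphism `restrictRetract in₁_K pr₁_K γ`
of the tree): it commutes with `a_K` for `a ∈ E_φ(H₁)` because `γ` commutes with `(in₁ a pr₁)_K`, and it preserves `(Q₁)_K`
because `(Q₁)_K(pr₁ γ in₁ x, pr₁ γ in₁ y) = (Q₁ ⊕ Q₂)_K(γ in₁ x, γ in₁ y) = (Q₁ ⊕ Q₂)_K(in₁ x, in₁ y) = (Q₁)_K(x, y)` (the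
`(2,1)`-block of `γ` vanishes). [cite: Milne1999LefschetzClasses, §1 Prop. 1.5 (p. 644) and Remark 1.6] [cite: Moonen2004MT, §4 Lemma 4.6] -/
theorem Polarization.restrictRetract_inl_fst_mem_lefschetzGroupBaseChange
    {γ : (K ⊗[ℚ] (V₁ × V₂)) ≃ₗ[K] (K ⊗[ℚ] (V₁ × V₂))} (hγ : γ ∈ (Q₁.prod Q₂).lefschetzGroupBaseChange K) :
    restrictRetract ((LinearMap.inl ℚ V₁ V₂).baseChange K) ((LinearMap.fst ℚ V₁ V₂).baseChange K)
        (baseChange_retract_apply K (ι := LinearMap.inl ℚ V₁ V₂) (π := LinearMap.fst ℚ V₁ V₂) fun _ ↦ rfl) γ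
        (Polarization.inl_fst_baseChange_apply_of_mem_lefschetzGroupBaseChange_prod hγ) ∈
      Q₁.lefschetzGroupBaseChange K := by
  rw [Polarization.mem_lefschetzGroupBaseChange_iff]
  refine ⟨fun a x ↦ ?_, fun x y ↦ ?_⟩
  · -- commutation with `a_K`, `a ∈ E_φ(H₁)`, from the commutation of `γ` with `(in₁ a pr₁)_K`
    simp only [restrictRetract_apply]
    have hA : (LinearMap.inl ℚ V₁ V₂ ∘ₗ (a : Module.End ℚ V₁) ∘ₗ LinearMap.fst ℚ V₁ V₂).baseChange K
          (γ ((LinearMap.inl ℚ V₁ V₂).baseChange K x)) =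
        γ ((LinearMap.inl ℚ V₁ V₂ ∘ₗ (a : Module.End ℚ V₁) ∘ₗ LinearMap.fst ℚ V₁ V₂).baseChange K
          ((LinearMap.inl ℚ V₁ V₂).baseChange K x)) :=
      hγ.1 ⟨_, inl_comp_comp_fst_mem_endAlg_prod H₁ H₂ a.2⟩ ((LinearMap.inl ℚ V₁ V₂).baseChange K x)
    simp only [LinearMap.baseChange_comp, LinearMap.coe_comp, Function.comp_apply, fst_baseChange_inl_baseChange'] at hA
    rw [← hA, fst_baseChange_inl_baseChange']
  · -- isometry for `(Q₁)_K`
    simp only [restrictRetract_apply]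
    have key := hγ.2 ((LinearMap.inl ℚ V₁ V₂).baseChange K x) ((LinearMap.inl ℚ V₁ V₂).baseChange K y)
    simpa only [Polarization.baseChange_prod_form_apply,
      Polarization.snd_baseChange_apply_inl_baseChange_of_mem_lefschetzGroupBaseChange_prod hγ, fst_baseChange_inl_baseChange',
      snd_baseChange_inl_baseChange', map_zero, LinearMap.zero_apply, add_zero] using key

/-- **The second block `pr₂ γ in₂` of `γ ∈ S(H₁ ⊕ H₂)(K)` lies in `S(H₂)(K)`.**
[cite: Milne1999LefschetzClasses, §1 Prop. 1.5 (p. 644) and Remark 1.6] [cite: Moonen2004MT, §4 Lemma 4.6] -/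
theorem Polarization.restrictRetract_inr_snd_mem_lefschetzGroupBaseChange
    {γ : (K ⊗[ℚ] (V₁ × V₂)) ≃ₗ[K] (K ⊗[ℚ] (V₁ × V₂))} (hγ : γ ∈ (Q₁.prod Q₂).lefschetzGroupBaseChange K) :
    restrictRetract ((LinearMap.inr ℚ V₁ V₂).baseChange K) ((LinearMap.snd ℚ V₁ V₂).baseChange K)
        (baseChange_retract_apply K (ι := LinearMap.inr ℚ V₁ V₂) (π := LinearMap.snd ℚ V₁ V₂) fun _ ↦ rfl) γ
        (Polarization.inr_snd_baseChange_apply_of_mem_lefschetzGroupBaseChange_prod hγ) ∈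
      Q₂.lefschetzGroupBaseChange K := by
  rw [Polarization.mem_lefschetzGroupBaseChange_iff]
  refine ⟨fun b y ↦ ?_, fun x y ↦ ?_⟩
  · simp only [restrictRetract_apply]
    have hB : (LinearMap.inr ℚ V₁ V₂ ∘ₗ (b : Module.End ℚ V₂) ∘ₗ LinearMap.snd ℚ V₁ V₂).baseChange K
          (γ ((LinearMap.inr ℚ V₁ V₂).baseChange K y)) =
        γ ((LinearMap.inr ℚ V₁ V₂ ∘ₗ (b : Module.End ℚ V₂) ∘ₗ LinearMap.snd ℚ V₁ V₂).baseChange K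
          ((LinearMap.inr ℚ V₁ V₂).baseChange K y)) :=
      hγ.1 ⟨_, inr_comp_comp_snd_mem_endAlg_prod H₁ H₂ b.2⟩ ((LinearMap.inr ℚ V₁ V₂).baseChange K y)
    simp only [LinearMap.baseChange_comp, LinearMap.coe_comp, Function.comp_apply, snd_baseChange_inr_baseChange'] at hB
    rw [← hB, snd_baseChange_inr_baseChange']
  · simp only [restrictRetract_apply]
    have key := hγ.2 ((LinearMap.inr ℚ V₁ V₂).baseChange K x) ((LinearMap.inr ℚ V₁ V₂).baseChange K y)
    simpa only [Polarization.baseChange_prod_form_apply,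
      Polarization.fst_baseChange_apply_inr_baseChange_of_mem_lefschetzGroupBaseChange_prod hγ, snd_baseChange_inr_baseChange',
      fst_baseChange_inr_baseChange', map_zero, LinearMap.zero_apply, zero_add] using key

/-- **`γ ∈ S(H₁ ⊕ H₂)(K)` is block diagonal**: `γ = (pr₁ γ in₁) ⊕ (pr₂ γ in₂)` (`γ` commutes with the base-changed idempotents
`(in₁ pr₁)_K`, `(in₂ pr₂)_K`, which sum to the identity). [cite: Milne1999LefschetzClasses, §1 Prop. 1.5 (p. 644) and Remark 1.6]
[cite: Moonen2004MT, §4 Lemma 4.6] -/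
theorem Polarization.eq_blockDiag_of_mem_lefschetzGroupBaseChange_prod
    {γ : (K ⊗[ℚ] (V₁ × V₂)) ≃ₗ[K] (K ⊗[ℚ] (V₁ × V₂))} (hγ : γ ∈ (Q₁.prod Q₂).lefschetzGroupBaseChange K) :
    γ = blockDiag K V₁ V₂
      (restrictRetract ((LinearMap.inl ℚ V₁ V₂).baseChange K) ((LinearMap.fst ℚ V₁ V₂).baseChange K)
          (baseChange_retract_apply K (ι := LinearMap.inl ℚ V₁ V₂) (π := LinearMap.fst ℚ V₁ V₂) fun _ ↦ rfl) γ
          (Polarization.inl_fst_baseChange_apply_of_mem_lefschetzGroupBaseChange_prod hγ),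
        restrictRetract ((LinearMap.inr ℚ V₁ V₂).baseChange K) ((LinearMap.snd ℚ V₁ V₂).baseChange K)
          (baseChange_retract_apply K (ι := LinearMap.inr ℚ V₁ V₂) (π := LinearMap.snd ℚ V₁ V₂) fun _ ↦ rfl) γ
          (Polarization.inr_snd_baseChange_apply_of_mem_lefschetzGroupBaseChange_prod hγ)) := by
  refine LinearEquiv.ext fun z ↦ ?_
  rw [← LinearEquiv.coe_coe (blockDiag K V₁ V₂ _), coe_blockDiag]
  simp only [LinearMap.add_apply, LinearMap.coe_comp, Function.comp_apply, LinearEquiv.coe_coe, restrictRetract_apply]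
  rw [Polarization.inl_fst_baseChange_apply_of_mem_lefschetzGroupBaseChange_prod hγ, fst_baseChange_inl_baseChange',
    Polarization.inr_snd_baseChange_apply_of_mem_lefschetzGroupBaseChange_prod hγ, snd_baseChange_inr_baseChange', ← map_add,
    inl_fst_add_inr_snd_baseChange_apply]

/-- **`S(H₁ ⊕ H₂)(K) ⊆ S(H₁)(K) × S(H₂)(K)` through the block-diagonal embedding**, for every field `K ⊇ ℚ` — Proposition 1.5's
map is onto `S(A)` exactly from this inclusion (Milne: "immediate consequence of Proposition 1.1", `C(A) ⊂ C(A₁) × C(A₂)`).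
[cite: Milne1999LefschetzClasses, §1 Prop. 1.5 (p. 644), Prop. 1.1 (p. 643) and Remark 1.6] -/
theorem Polarization.lefschetzGroupBaseChange_prod_le_map_blockDiag (K : Type uK) [Field K] [Algebra ℚ K]
    (Q₁ : Polarization H₁) (Q₂ : Polarization H₂) :
    (Q₁.prod Q₂).lefschetzGroupBaseChange K ≤
      ((Q₁.lefschetzGroupBaseChange K).prod (Q₂.lefschetzGroupBaseChange K)).map (blockDiag K V₁ V₂) := fun _ hγ ↦
  ⟨(_, _), ⟨Polarization.restrictRetract_inl_fst_mem_lefschetzGroupBaseChange hγ,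
    Polarization.restrictRetract_inr_snd_mem_lefschetzGroupBaseChange hγ⟩,
    (Polarization.eq_blockDiag_of_mem_lefschetzGroupBaseChange_prod hγ).symm⟩

end Restrict

/-! ## §2 Block-diagonal elements of `S(H₁ ⊕ H₂)(K)`: the intertwining relations -/

section Blocks

variable {K}

/-- **`γ₁ ⊕ γ₂ ∈ S(H₁ ⊕ H₂)(K)`, exactly** (for the product polarization): iff `γ₁ ∈ S(H₁)(K)`, `γ₂ ∈ S(H₂)(K)` and the pair
intertwines the base change of every morphism between the summands (`f_K γ₁ = γ₂ f_K` for `f : H₁ → H₂`, `g_K γ₂ = γ₁ g_K` for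
`g : H₂ → H₁`). "⟹": `γᵢ` are the blocks (§1), and `γ₁ ⊕ γ₂` commutes with `(in₂ f pr₁)_K`, `(in₁ g pr₂)_K ∈ E_φ(H₁ ⊕ H₂) ⊗ K`;
"⟸": every `a ∈ E_φ(H₁ ⊕ H₂)` is the sum of its four blocks `pr₁ a in₁ ∈ E_φ(H₁)`, `pr₂ a in₂ ∈ E_φ(H₂)`,
`pr₂ a in₁ ∈ Hom(H₁, H₂)`, `pr₁ a in₂ ∈ Hom(H₂, H₁)` (g18-#3), each of which `γ₁ ⊕ γ₂` intertwines; the form clause is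
componentwise (§0). [cite: Milne1999LefschetzClasses, §1 Prop. 1.5 (p. 644), Prop. 1.1 (p. 643) and Remark 1.6] -/
theorem Polarization.blockDiag_mem_lefschetzGroupBaseChange_prod_iff
    (γ₁ : (K ⊗[ℚ] V₁) ≃ₗ[K] (K ⊗[ℚ] V₁)) (γ₂ : (K ⊗[ℚ] V₂) ≃ₗ[K] (K ⊗[ℚ] V₂)) :
    blockDiag K V₁ V₂ (γ₁, γ₂) ∈ (Q₁.prod Q₂).lefschetzGroupBaseChange K ↔
      γ₁ ∈ Q₁.lefschetzGroupBaseChange K ∧ γ₂ ∈ Q₂.lefschetzGroupBaseChange K ∧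
        (∀ f : Hom H₁ H₂, ∀ x, f.toLinearMap.baseChange K (γ₁ x) = γ₂ (f.toLinearMap.baseChange K x)) ∧
          ∀ g : Hom H₂ H₁, ∀ y, g.toLinearMap.baseChange K (γ₂ y) = γ₁ (g.toLinearMap.baseChange K y) := by
  constructor
  · intro hγ
    -- the blocks of `γ₁ ⊕ γ₂` are `γ₁`, `γ₂`
    have e₁ : restrictRetract ((LinearMap.inl ℚ V₁ V₂).baseChange K) ((LinearMap.fst ℚ V₁ V₂).baseChange K)
        (baseChange_retract_apply K (ι := LinearMap.inl ℚ V₁ V₂) (π := LinearMap.fst ℚ V₁ V₂) fun _ ↦ rfl)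
        (blockDiag K V₁ V₂ (γ₁, γ₂)) (Polarization.inl_fst_baseChange_apply_of_mem_lefschetzGroupBaseChange_prod hγ) = γ₁ := by
      refine LinearEquiv.ext fun x ↦ ?_
      rw [restrictRetract_apply, blockDiag_apply_inl_baseChange, fst_baseChange_inl_baseChange']
    have e₂ : restrictRetract ((LinearMap.inr ℚ V₁ V₂).baseChange K) ((LinearMap.snd ℚ V₁ V₂).baseChange K)
        (baseChange_retract_apply K (ι := LinearMap.inr ℚ V₁ V₂) (π := LinearMap.snd ℚ V₁ V₂) fun _ ↦ rfl)
        (blockDiag K V₁ V₂ (γ₁, γ₂)) (Polarization.inr_snd_baseChange_apply_of_mem_lefschetzGroupBaseChange_prod hγ) = γ₂ := by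
      refine LinearEquiv.ext fun y ↦ ?_
      rw [restrictRetract_apply, blockDiag_apply_inr_baseChange, snd_baseChange_inr_baseChange']
    have h₁ := Polarization.restrictRetract_inl_fst_mem_lefschetzGroupBaseChange hγ
    have h₂ := Polarization.restrictRetract_inr_snd_mem_lefschetzGroupBaseChange hγ
    rw [e₁] at h₁
    rw [e₂] at h₂
    refine ⟨h₁, h₂, fun f x ↦ ?_, fun g y ↦ ?_⟩
    · -- `γ₁ ⊕ γ₂` commutes with `(in₂ f pr₁)_K`; evaluate at `in₁ x` and project with `pr₂`
      have h : (LinearMap.inr ℚ V₁ V₂ ∘ₗ f.toLinearMap ∘ₗ LinearMap.fst ℚ V₁ V₂).baseChange K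
            (blockDiag K V₁ V₂ (γ₁, γ₂) ((LinearMap.inl ℚ V₁ V₂).baseChange K x)) =
          blockDiag K V₁ V₂ (γ₁, γ₂) ((LinearMap.inr ℚ V₁ V₂ ∘ₗ f.toLinearMap ∘ₗ LinearMap.fst ℚ V₁ V₂).baseChange K
            ((LinearMap.inl ℚ V₁ V₂).baseChange K x)) :=
        hγ.1 ⟨_, inr_comp_hom_comp_fst_mem_endAlg_prod H₁ H₂ f⟩ ((LinearMap.inl ℚ V₁ V₂).baseChange K x)
      simp only [LinearMap.baseChange_comp, LinearMap.coe_comp, Function.comp_apply, blockDiag_apply_inl_baseChange,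
        blockDiag_apply_inr_baseChange, fst_baseChange_inl_baseChange'] at h
      have h' := congrArg ((LinearMap.snd ℚ V₁ V₂).baseChange K) h
      rwa [snd_baseChange_inr_baseChange', snd_baseChange_inr_baseChange'] at h'
    · have h : (LinearMap.inl ℚ V₁ V₂ ∘ₗ g.toLinearMap ∘ₗ LinearMap.snd ℚ V₁ V₂).baseChange K
            (blockDiag K V₁ V₂ (γ₁, γ₂) ((LinearMap.inr ℚ V₁ V₂).baseChange K y)) =
          blockDiag K V₁ V₂ (γ₁, γ₂) ((LinearMap.inl ℚ V₁ V₂ ∘ₗ g.toLinearMap ∘ₗ LinearMap.snd ℚ V₁ V₂).baseChange K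
            ((LinearMap.inr ℚ V₁ V₂).baseChange K y)) :=
        hγ.1 ⟨_, inl_comp_hom_comp_snd_mem_endAlg_prod H₁ H₂ g⟩ ((LinearMap.inr ℚ V₁ V₂).baseChange K y)
      simp only [LinearMap.baseChange_comp, LinearMap.coe_comp, Function.comp_apply, blockDiag_apply_inl_baseChange,
        blockDiag_apply_inr_baseChange, snd_baseChange_inr_baseChange'] at h
      have h' := congrArg ((LinearMap.fst ℚ V₁ V₂).baseChange K) h
      rwa [fst_baseChange_inl_baseChange', fst_baseChange_inl_baseChange'] at h'
  · rintro ⟨h₁, h₂, hf, hg⟩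
    refine ⟨fun a z ↦ ?_, fun z z' ↦ ?_⟩
    · -- commutation with `a_K`: decompose `a ∈ E_φ(H₁ ⊕ H₂)` into its four blocks and `z` along the two idempotents
      obtain ⟨f, hf'⟩ := exists_hom_toLinearMap_eq_snd_comp_comp_inl H₁ H₂ a.2
      obtain ⟨g, hg'⟩ := exists_hom_toLinearMap_eq_fst_comp_comp_inr H₁ H₂ a.2
      have ha₁₁ : ∀ x, (LinearMap.fst ℚ V₁ V₂ ∘ₗ (a : Module.End ℚ (V₁ × V₂)) ∘ₗ LinearMap.inl ℚ V₁ V₂).baseChange K (γ₁ x) =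
          γ₁ ((LinearMap.fst ℚ V₁ V₂ ∘ₗ (a : Module.End ℚ (V₁ × V₂)) ∘ₗ LinearMap.inl ℚ V₁ V₂).baseChange K x) :=
        h₁.1 ⟨_, fst_comp_comp_inl_mem_endAlg H₁ H₂ a.2⟩
      have ha₂₂ : ∀ y, (LinearMap.snd ℚ V₁ V₂ ∘ₗ (a : Module.End ℚ (V₁ × V₂)) ∘ₗ LinearMap.inr ℚ V₁ V₂).baseChange K (γ₂ y) =
          γ₂ ((LinearMap.snd ℚ V₁ V₂ ∘ₗ (a : Module.End ℚ (V₁ × V₂)) ∘ₗ LinearMap.inr ℚ V₁ V₂).baseChange K y) :=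
        h₂.1 ⟨_, snd_comp_comp_inr_mem_endAlg H₁ H₂ a.2⟩
      have ha₂₁ : ∀ x, (LinearMap.snd ℚ V₁ V₂ ∘ₗ (a : Module.End ℚ (V₁ × V₂)) ∘ₗ LinearMap.inl ℚ V₁ V₂).baseChange K (γ₁ x) =
          γ₂ ((LinearMap.snd ℚ V₁ V₂ ∘ₗ (a : Module.End ℚ (V₁ × V₂)) ∘ₗ LinearMap.inl ℚ V₁ V₂).baseChange K x) := by
        rw [← hf']
        exact hf f
      have ha₁₂ : ∀ y, (LinearMap.fst ℚ V₁ V₂ ∘ₗ (a : Module.End ℚ (V₁ × V₂)) ∘ₗ LinearMap.inr ℚ V₁ V₂).baseChange K (γ₂ y) =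
          γ₁ ((LinearMap.fst ℚ V₁ V₂ ∘ₗ (a : Module.End ℚ (V₁ × V₂)) ∘ₗ LinearMap.inr ℚ V₁ V₂).baseChange K y) := by
        rw [← hg']
        exact hg g
      rw [← inl_fst_add_inr_snd_baseChange_apply K z]
      simp only [map_add, blockDiag_apply_inl_baseChange, blockDiag_apply_inr_baseChange,
        baseChange_apply_inl_baseChange K (a : Module.End ℚ (V₁ × V₂)),
        baseChange_apply_inr_baseChange K (a : Module.End ℚ (V₁ × V₂)), ha₁₁, ha₂₂, ha₂₁, ha₁₂]
    · -- isometry, componentwise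
      rw [Polarization.baseChange_prod_form_apply, Polarization.baseChange_prod_form_apply, fst_baseChange_blockDiag_apply,
        fst_baseChange_blockDiag_apply, snd_baseChange_blockDiag_apply, snd_baseChange_blockDiag_apply, h₁.2, h₂.2]

end Blocks

/-! ## §3 Proposition 1.5 on `K`-points: `S(H₁)(K) × S(H₂)(K) ≅ S(H₁ ⊕ H₂)(K)` iff `Hom(H₁, H₂) = 0 = Hom(H₂, H₁)` -/

section PropOneFive

/-- In a `ℚ`-vector space `-x = x` forces `x = 0`. Private plumbing. [folklore] -/
private theorem eq_zero_of_neg_eq_self' {W : Type*} [AddCommGroup W] [Module ℚ W] {x : W} (h : -x = x) : x = 0 := by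
  have h2 : (2 : ℚ) • x = 0 := by
    rw [two_smul]
    nth_rw 1 [← h]
    exact neg_add_cancel x
  exact (smul_eq_zero.1 h2).resolve_left (by norm_num)

/-- `-id ∈ S(H)(K)` (it commutes with everything and preserves every bilinear form); `-id` is Mathlib's `LinearEquiv.neg K`.
[cite: Milne1999LefschetzClasses, §1 p. 644 L16–L20 (the group S(A))] -/
theorem Polarization.neg_mem_lefschetzGroupBaseChange {V : Type u} [AddCommGroup V] [Module ℚ V] {H : HodgeStructure V n}
    (Q : Polarization H) : LinearEquiv.neg K ∈ Q.lefschetzGroupBaseChange K := by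
  refine ⟨fun a x ↦ ?_, fun x y ↦ ?_⟩
  · rw [LinearEquiv.neg_apply, LinearEquiv.neg_apply, map_neg]
  · rw [LinearEquiv.neg_apply, LinearEquiv.neg_apply, map_neg, map_neg, LinearMap.neg_apply, neg_neg]

/-- A morphism of Hodge structures vanishes as soon as its base change to a field `K ⊇ ℚ` does (`K` is faithfully flat over `ℚ`;
Mathlib's `LinearMap.baseChangeHom_injective`). [cite: BourbakiAlgebraI1989, Ch. II §5 no. 3 Prop. 7 (ii)] -/
theorem Hom.toLinearMap_eq_zero_of_baseChange_eq_zero {f : Hom H₁ H₂}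
    (hf : ∀ x : K ⊗[ℚ] V₁, f.toLinearMap.baseChange K x = 0) : f.toLinearMap = 0 := by
  haveI : Module.Free ℚ V₂ := Module.Free.of_divisionRing ℚ V₂
  apply LinearMap.baseChangeHom_injective (R := ℚ) (S := K) (M := V₁) (N := V₂)
  rw [LinearMap.baseChangeHom_apply, LinearMap.baseChangeHom_apply, LinearMap.baseChange_zero]
  exact LinearMap.ext hf

/-- **Proposition 1.5 on `K`-points, `s = 2`: "`S(A₁) × S(A₂) → S(A)` is an isomorphism" exactly when there are no morphisms
between the summands** (Milne: representatives of distinct simple isogeny classes): for a field `K ⊇ ℚ`, `γ₁ ⊕ γ₂ ∈ S(H₁ ⊕ H₂)(K)`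
for ALL `γᵢ ∈ S(Hᵢ)(K)` iff `Hom(H₁, H₂) = 0` and `Hom(H₂, H₁) = 0` ("⟹": `(1, -1) ∈ S(H₁)(K) × S(H₂)(K)` intertwines `f_K` only if
`-f_K = f_K`, and `f_K = 0 ⟹ f = 0`). [cite: Milne1999LefschetzClasses, §1 Prop. 1.5 (p. 644) and Remark 1.6] -/
theorem Polarization.forall_blockDiag_mem_lefschetzGroupBaseChange_prod_iff :
    (∀ γ₁ ∈ Q₁.lefschetzGroupBaseChange K, ∀ γ₂ ∈ Q₂.lefschetzGroupBaseChange K,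
        blockDiag K V₁ V₂ (γ₁, γ₂) ∈ (Q₁.prod Q₂).lefschetzGroupBaseChange K) ↔
      (∀ f : Hom H₁ H₂, f.toLinearMap = 0) ∧ ∀ g : Hom H₂ H₁, g.toLinearMap = 0 := by
  constructor
  · intro h
    have h1 := (Q₁.blockDiag_mem_lefschetzGroupBaseChange_prod_iff Q₂ 1 (LinearEquiv.neg K)).1
      (h 1 (Subgroup.one_mem _) (LinearEquiv.neg K) (Q₂.neg_mem_lefschetzGroupBaseChange K))
    refine ⟨fun f ↦ Hom.toLinearMap_eq_zero_of_baseChange_eq_zero K fun x ↦ ?_,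
      fun g ↦ Hom.toLinearMap_eq_zero_of_baseChange_eq_zero K fun y ↦ ?_⟩
    · -- `f_K x = -(f_K x)`
      have hf := h1.2.2.1 f x
      rw [LinearEquiv.coe_one, id_eq, LinearEquiv.neg_apply] at hf
      exact eq_zero_of_neg_eq_self' hf.symm
    · -- `g_K (-y) = g_K y`
      have hg := h1.2.2.2 g y
      rw [LinearEquiv.coe_one, id_eq, LinearEquiv.neg_apply, map_neg] at hg
      exact eq_zero_of_neg_eq_self' hg
  · rintro ⟨hf, hg⟩ γ₁ h₁ γ₂ h₂
    exact (Q₁.blockDiag_mem_lefschetzGroupBaseChange_prod_iff Q₂ γ₁ γ₂).2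
      ⟨h₁, h₂, fun f x ↦ by rw [hf f, LinearMap.baseChange_zero, LinearMap.zero_apply, LinearMap.zero_apply, map_zero],
        fun g y ↦ by rw [hg g, LinearMap.baseChange_zero, LinearMap.zero_apply, LinearMap.zero_apply, map_zero]⟩

/-- **`S(H₁ ⊕ H₂)(K) = S(H₁)(K) × S(H₂)(K)` (block-diagonally embedded) when `Hom(H₁, H₂) = 0 = Hom(H₂, H₁)`**, for every field
`K ⊇ ℚ`; with the tree's `blockDiag_injective` this is the isomorphism `S(A₁) × S(A₂) ≅ S(A)` of Proposition 1.5 (`s = 2`) on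
`K`-points (e.g. through Mathlib's `Subgroup.equivMapOfInjective`). [cite: Milne1999LefschetzClasses, §1 Prop. 1.5 (p. 644) and Remark 1.6] -/
theorem Polarization.lefschetzGroupBaseChange_prod_eq_map_blockDiag_of_hom_eq_zero (hf : ∀ f : Hom H₁ H₂, f.toLinearMap = 0)
    (hg : ∀ g : Hom H₂ H₁, g.toLinearMap = 0) :
    (Q₁.prod Q₂).lefschetzGroupBaseChange K =
      ((Q₁.lefschetzGroupBaseChange K).prod (Q₂.lefschetzGroupBaseChange K)).map (blockDiag K V₁ V₂) := by
  refine le_antisymm (Q₁.lefschetzGroupBaseChange_prod_le_map_blockDiag K Q₂) ?_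
  rintro _ ⟨⟨γ₁, γ₂⟩, ⟨hγ₁, hγ₂⟩, rfl⟩
  exact (Q₁.forall_blockDiag_mem_lefschetzGroupBaseChange_prod_iff K Q₂).2 ⟨hf, hg⟩ γ₁ hγ₁ γ₂ hγ₂

/-- Membership form of the previous statement: when the summands have no morphisms between them, `γ ∈ S(H₁ ⊕ H₂)(K)` iff
`γ = γ₁ ⊕ γ₂` with `γᵢ ∈ S(Hᵢ)(K)`. [cite: Milne1999LefschetzClasses, §1 Prop. 1.5 (p. 644) and Remark 1.6] -/
theorem Polarization.mem_lefschetzGroupBaseChange_prod_iff_of_hom_eq_zero (hf : ∀ f : Hom H₁ H₂, f.toLinearMap = 0)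
    (hg : ∀ g : Hom H₂ H₁, g.toLinearMap = 0) (γ : (K ⊗[ℚ] (V₁ × V₂)) ≃ₗ[K] (K ⊗[ℚ] (V₁ × V₂))) :
    γ ∈ (Q₁.prod Q₂).lefschetzGroupBaseChange K ↔
      ∃ γ₁ ∈ Q₁.lefschetzGroupBaseChange K, ∃ γ₂ ∈ Q₂.lefschetzGroupBaseChange K, γ = blockDiag K V₁ V₂ (γ₁, γ₂) := by
  rw [Q₁.lefschetzGroupBaseChange_prod_eq_map_blockDiag_of_hom_eq_zero K Q₂ hf hg, Subgroup.mem_map]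
  constructor
  · rintro ⟨⟨γ₁, γ₂⟩, ⟨h₁, h₂⟩, rfl⟩
    exact ⟨γ₁, h₁, γ₂, h₂, rfl⟩
  · rintro ⟨γ₁, h₁, γ₂, h₂, rfl⟩
    exact ⟨(γ₁, γ₂), ⟨h₁, h₂⟩, rfl⟩

end PropOneFive

/-! ## §4 Powers: "`S(A) = S(A^r)`" on `K`-points (`r = 2`, the diagonal) -/

section Powers

variable {K} {V : Type u} [AddCommGroup V] [Module ℚ V] {H : HodgeStructure V n} (Q : Polarization H)

/-- **`γ₁ ⊕ γ₂ ∈ S(H ⊕ H)(K) ⟺ γ₁ = γ₂ ∈ S(H)(K)`** (intertwining with `id ∈ Hom(H, H)` forces `γ₁ = γ₂`; conversely `γ ∈ S(H)(K)`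
intertwines `f_K` for every `f ∈ Hom(H, H) = E_φ`). [cite: Milne1999LefschetzClasses, §3 p. 654 ("S(A) = S(A^r)") and §1 Prop. 1.5, Remark 1.6] -/
theorem Polarization.blockDiag_mem_lefschetzGroupBaseChange_prod_self_iff
    (γ₁ γ₂ : (K ⊗[ℚ] V) ≃ₗ[K] (K ⊗[ℚ] V)) :
    blockDiag K V V (γ₁, γ₂) ∈ (Q.prod Q).lefschetzGroupBaseChange K ↔ γ₁ ∈ Q.lefschetzGroupBaseChange K ∧ γ₂ = γ₁ := by
  rw [Q.blockDiag_mem_lefschetzGroupBaseChange_prod_iff Q]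
  constructor
  · rintro ⟨h₁, -, hf, -⟩
    refine ⟨h₁, LinearEquiv.ext fun x ↦ ?_⟩
    have h := hf (Hom.id H) x
    change (LinearMap.id : V →ₗ[ℚ] V).baseChange K (γ₁ x) = γ₂ ((LinearMap.id : V →ₗ[ℚ] V).baseChange K x) at h
    rw [LinearMap.baseChange_id, LinearMap.id_apply, LinearMap.id_apply] at h
    exact h.symm
  · rintro ⟨h₁, rfl⟩
    exact ⟨h₁, h₁, fun f x ↦ h₁.1 ⟨f.toLinearMap, Hom.toLinearMap_mem_endAlg f⟩ x,
      fun g y ↦ h₁.1 ⟨g.toLinearMap, Hom.toLinearMap_mem_endAlg g⟩ y⟩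

/-- **"`S(A) = S(A^r)`" on `K`-points** (`r = 2`, the diagonal action): `S(H ⊕ H)(K) = Δ S(H)(K)`, the image of `S(H)(K)` under
the diagonal embedding `γ ↦ γ ⊕ γ` of the tree (`diagEmbedding`). [cite: Milne1999LefschetzClasses, §3 p. 654 ("It follows from Proposition 1.5 that S(A) = S(A^r)") and Remark 1.6] -/
theorem Polarization.lefschetzGroupBaseChange_prod_self_eq_map_diagEmbedding (K : Type uK) [Field K] [Algebra ℚ K] :
    (Q.prod Q).lefschetzGroupBaseChange K = (Q.lefschetzGroupBaseChange K).map (diagEmbedding K V) := by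
  refine le_antisymm (fun γ hγ ↦ ?_) ?_
  · obtain ⟨⟨γ₁, γ₂⟩, -, hγ'⟩ := Q.lefschetzGroupBaseChange_prod_le_map_blockDiag K Q hγ
    rw [← hγ'] at hγ
    obtain ⟨h₁, h₂⟩ := (Q.blockDiag_mem_lefschetzGroupBaseChange_prod_self_iff γ₁ γ₂).1 hγ
    refine ⟨γ₁, h₁, ?_⟩
    rw [diagEmbedding_apply, ← hγ', h₂]
  · rintro _ ⟨γ₀, h₀, rfl⟩
    rw [diagEmbedding_apply]
    exact (Q.blockDiag_mem_lefschetzGroupBaseChange_prod_self_iff γ₀ γ₀).2 ⟨h₀, rfl⟩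

/-- Membership form: `γ ∈ S(H ⊕ H)(K)` iff `γ = γ₀ ⊕ γ₀` for some `γ₀ ∈ S(H)(K)`.
[cite: Milne1999LefschetzClasses, §3 p. 654 ("S(A) = S(A^r)") and Remark 1.6] -/
theorem Polarization.mem_lefschetzGroupBaseChange_prod_self_iff (γ : (K ⊗[ℚ] (V × V)) ≃ₗ[K] (K ⊗[ℚ] (V × V))) :
    γ ∈ (Q.prod Q).lefschetzGroupBaseChange K ↔ ∃ γ₀ ∈ Q.lefschetzGroupBaseChange K, γ = diagEmbedding K V γ₀ := by
  rw [Q.lefschetzGroupBaseChange_prod_self_eq_map_diagEmbedding K, Subgroup.mem_map]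
  constructor
  · rintro ⟨γ₀, h₀, rfl⟩
    exact ⟨γ₀, h₀, rfl⟩
  · rintro ⟨γ₀, h₀, rfl⟩
    exact ⟨γ₀, h₀, rfl⟩

end Powers

end HodgeStructure

end Literature.AlgebraicGeometry.Motives
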